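import Mathlib
import Literature.AlgebraicGeometry.Resolution.CobordantGame
import Literature.AlgebraicGeometry.Resolution.CobordantChartCoefficients
import Literature.AlgebraicGeometry.Resolution.CobordantChartPlaneSlice
import Literature.AlgebraicGeometry.Resolution.CobordantTupleGame
import Literature.AlgebraicGeometry.Resolution.FormalCoordinateChange
import Summits.ResolutionOfSingularities.ResolutionOfSingularities.Theorems.WeightedInvariantLocalWeightedDropMonicPointBlowup

/-!
# `WeightedInvariant.LocalWeightedDrop`: the blow-up of a permissible LINEAR centre `V(x_S, y)` from a MONIC form
# (every dimension, every degree, every tame weight vector on the old variables)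

Crux item stmt-ResolutionOfSingularities-8899 `LocalWeightedDrop` (route `ResolutionOfSingularities/WeightedInvariant`), skeleton
v29, residual stubs W4|₄ `stub_wildWideApexFourStartsWon` / W4|₅₊ `stub_wildWideApexFiveUpStartsWon`.  [OURS · L1 W4.3, chain w43,
stub worker 4 (gen 4): the THIRD move-brick for monic forms, after `won_monic_of_pointBlowup` (all old slots, stub worker 3) and
`won_monic_of_curveBlowup` (one old slot, stub worker 3); needed from `m = 3` old variables on, where the end-game of the terminal
double points `y² + x₀x₁x₂·U` must blow up the LINE `V(x₀, x₁, y)` — the point blow-up reproduces the shape and no coordinate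
surface `V(x_i, y)` is permissible.  Not a statement of any manuscript.]

`won_monic_of_linearBlowup` (every characteristic `p`, every dimension `m + 1`, every degree `d ≥ 1`, every weight vector `w` on
the old variables whose positive entries are prime to `p`): let `P = y^d + Σ_{j<d} A_j(x') y^j` be PERMISSIBLE for the centre
`(x'^{1/w}, y^{1/1})`, i.e. at every exceptional point `c` of the old slots the chart transform factors as
`A_j ∘ chart_w(c) = s^{d-j} · B_j` with `B_j(0) = 0`.  Blow up with weights `(w, 1)` and no coordinate change.  Then
* the transform at `pt = (c, γ)` is `s^d · g₀`, `g₀ = (γ + Y)^d + Σ_j B_j♮ (γ + Y)^j` (`MonicLinearBlowup.transform_linear`), and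
  `s ∤ g₀` (`not_X_dvd_g₀`: killing every variable but `Y` leaves `(γ + Y)^d + Σ_j B_j(0) (γ + Y)^j`, whose `Y^d`-coefficient is `1`),
  so `g₀` IS the `s`-saturated successor;
* a singular successor has `g₀(0) = γ^d = 0` (`constantCoeff_g₀`), hence lies over `γ = 0` and has a live OLD slot `i₀`
  (`c_{i₀} ≠ 0`, `w_{i₀} > 0` prime to `p`: tame), where `tameSlice` writes `g₀ = u · Φ(cyl S)` with `S` the slice
  `y^d + Σ_j (B_j)|_{x'_{i₀} = 0} y^j` (`slice_g₀`) — a MONIC form in the same number of variables;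
hence `P` is won as soon as every such SINGULAR slice is won (`won_cyl`, `won_subst_iff`, `won_unit_mul_iff`).
With `w = (1,…,1)` and `B_j := s · B'_j` this is the point brick, with `w = e_i` the curve brick; the new cases are the
intermediate linear centres `w = 𝟙_S`, `S ⊆ {old slots}`.
-/

set_option linter.dupNamespace false -- mandated namespace of this single-conjunct summit

namespace Summit.ResolutionOfSingularities.ResolutionOfSingularities.Theorems

open Literature.AlgebraicGeometry.Resolution
open Literature.AlgebraicGeometry.Resolution.CobordantGame

namespace MonicLinearBlowup

open MvPowerSeries

variable {k : Type} [Field k] {m : ℕ} (w : Fin m → ℕ)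

/-- The weights `(w, 1)` restricted to the old slots are `w`. -/
theorem insertNth_castSucc (l : Fin m) :
    Fin.insertNth (α := fun _ => ℕ) (Fin.last m) 1 w (Fin.castSucc l) = w l := by
  rw [← Fin.succAbove_last, Fin.insertNth_apply_succAbove]

/-- THE TRANSFORM OF A PERMISSIBLE MONIC FORM under the blow-up with weights `(w, 1)` at the exceptional point `pt = (c, γ)`,
given the factorisations `A_j ∘ chart_w(c) = s^{d-j} · B_j`:  `s^d · ((γ + Y)^d + Σ_j B_j♮ (γ + Y)^j)`. -/
theorem transform_linear {d : ℕ} (A : Fin d → MvPowerSeries (Fin m) k) (pt : Fin (m + 1) → k)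
    (B : Fin d → MvPowerSeries (Fin (m + 1)) k)
    (hB : ∀ j, subst (CobordantChart.chart w (fun l => if 0 < w l then pt (Fin.castSucc l) else 0)) (A j) =
      X 0 ^ (d - (j : ℕ)) * B j) :
    subst (cruxChart k (Fin.insertNth (α := fun _ => ℕ) (Fin.last m) 1 w) pt)
        (X (Fin.last m) ^ d + ∑ j : Fin d, rename (Fin.succAboveEmb (Fin.last m)) (A j) * X (Fin.last m) ^ (j : ℕ)) =
      X 0 ^ d * ((C (pt (Fin.last m)) + X (Fin.last (m + 1))) ^ d +
        ∑ j : Fin d, rename (Fin.succAboveEmb (Fin.last (m + 1))) (B j) *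
          (C (pt (Fin.last m)) + X (Fin.last (m + 1))) ^ (j : ℕ)) := by
  set Wt : Fin (m + 1) → ℕ := Fin.insertNth (α := fun _ => ℕ) (Fin.last m) 1 w with hWt
  have hs := hasSubst_of_constantCoeff_zero (constantCoeff_cruxChart (k := k) Wt pt)
  have hlast : subst (cruxChart k Wt pt) (X (Fin.last m) : MvPowerSeries (Fin (m + 1)) k) =
      X 0 * (C (pt (Fin.last m)) + X (Fin.last (m + 1))) := by
    rw [subst_X hs, MultiplicityLift.cruxChart_last hWt pt, pow_one, if_pos one_pos]
  have hc' : (fun i => pt ((Fin.last m).succAbove i)) = fun i => pt (Fin.castSucc i) := by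
    funext i; rw [Fin.succAbove_last]
  have hchart : cruxChart k w (fun i => pt (Fin.castSucc i)) =
      CobordantChart.chart w (fun l => if 0 < w l then pt (Fin.castSucc l) else 0) :=
    CobordantChart.cruxChart_eq_chart w _
  have hren : ∀ j, subst (cruxChart k Wt pt) (rename (Fin.succAboveEmb (Fin.last m)) (A j)) =
      rename (Fin.succAboveEmb (Fin.last (m + 1))) (X 0 ^ (d - (j : ℕ)) * B j) := by
    intro j
    rw [MultiplicityLift.subst_cruxChart_rename hWt pt (A j), hc', hchart, hB j]
  have h0 : (Fin.succAboveEmb (Fin.last (m + 1))) (0 : Fin (m + 1)) = 0 := succAboveEmb_succ_zero (Fin.last m)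
  rw [← coe_substAlgHom hs]
  simp only [map_add, map_pow, map_sum, map_mul, coe_substAlgHom, hlast, hren, rename_X, h0]
  rw [mul_add (X 0 ^ d), mul_pow, Finset.mul_sum]
  congr 1
  refine Finset.sum_congr rfl fun j _ => ?_
  have hj : (j : ℕ) < d := j.2
  have hd : (X 0 : MvPowerSeries (Fin (m + 1 + 1)) k) ^ d = X 0 ^ (j : ℕ) * X 0 ^ (d - (j : ℕ)) := by
    rw [← pow_add]; congr 1; omega
  rw [hd, mul_pow]
  ring

/-- The constant coefficient of `g₀ = (γ + Y)^d + Σ_j B_j♮ (γ + Y)^j` is `γ^d` when the `B_j` vanish at the origin. -/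
theorem constantCoeff_g₀ {d : ℕ} (γ : k) (B : Fin d → MvPowerSeries (Fin (m + 1)) k)
    (hB0 : ∀ j, constantCoeff (B j) = 0) :
    constantCoeff ((C γ + X (Fin.last (m + 1))) ^ d +
        ∑ j : Fin d, rename (Fin.succAboveEmb (Fin.last (m + 1))) (B j) * (C γ + X (Fin.last (m + 1))) ^ (j : ℕ)) =
      γ ^ d := by
  rw [map_add, map_pow, map_add, constantCoeff_C, constantCoeff_X, add_zero, map_sum, Finset.sum_eq_zero, add_zero]
  intro j _
  rw [map_mul, constantCoeff_rename, hB0 j, zero_mul]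

/-- `s` does not divide `g₀ = (γ + Y)^d + Σ_j B_j♮ (γ + Y)^j`: killing every variable but `Y` leaves
`(γ + Y)^d + Σ_j B_j(0) (γ + Y)^j`, whose `Y^d`-coefficient is `1`. -/
theorem not_X_dvd_g₀ {d : ℕ} (γ : k) (B : Fin d → MvPowerSeries (Fin (m + 1)) k) :
    ¬ X 0 ∣ ((C γ + X (Fin.last (m + 1))) ^ d +
        ∑ j : Fin d, rename (Fin.succAboveEmb (Fin.last (m + 1))) (B j) * (C γ + X (Fin.last (m + 1))) ^ (j : ℕ)) := by
  classical
  rintro ⟨q, hq⟩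
  obtain ⟨π, hπ⟩ : ∃ π : Fin (m + 1 + 1) → MvPowerSeries (Fin (m + 1 + 1)) k,
      ∀ l, π l = if l = Fin.last (m + 1) then X l else 0 := ⟨_, fun _ => rfl⟩
  have hπs : HasSubst π := CriticalSection.hasSubst_indSubst hπ
  have h := congrArg (subst π) hq
  rw [← coe_substAlgHom hπs] at h
  simp only [map_add, map_pow, map_sum, map_mul, coe_substAlgHom, MultiplicityLift.subst_proj_X_zero hπ,
    MultiplicityLift.subst_proj_X_last hπ, MultiplicityLift.subst_proj_rename hπ, subst_C, zero_mul] at h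
  -- now `h : (C γ + Y)^d + Σ_j C (B_j(0)) (C γ + Y)^j = 0`; read the `Y^d` coefficient
  have hc := congrArg (coeff (Finsupp.single (Fin.last (m + 1)) d)) h
  rw [map_zero, map_add, map_sum, ← one_mul ((C γ + X (Fin.last (m + 1))) ^ d), ← map_one C,
    MultiplicityLift.coeff_single_C_mul_add_pow, Nat.choose_self, Nat.sub_self, Finset.sum_eq_zero] at hc
  · simp at hc
  · intro j _
    rw [MultiplicityLift.coeff_single_C_mul_add_pow, Nat.choose_eq_zero_of_lt j.2]
    simp

/-- THE SLICE `x'_{i₀} ↦ 0` of `g₀` at `γ = 0` is the MONIC form `y^d + Σ_j (B_j)|_{x'_{i₀} = 0} y^j` (same number of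
variables, the exceptional variable `s` in slot `0`). -/
theorem slice_g₀ {d : ℕ} (i₀ : Fin m) (B : Fin d → MvPowerSeries (Fin (m + 1)) k) :
    subst (fun j : Fin (m + 1 + 1) => if j = (Fin.castSucc i₀).succ then (0 : MvPowerSeries (Fin (m + 1)) k)
        else X (Fin.predAbove (Fin.castSucc i₀) j))
      ((C (0 : k) + X (Fin.last (m + 1))) ^ d +
        ∑ j : Fin d, rename (Fin.succAboveEmb (Fin.last (m + 1))) (B j) * (C (0 : k) + X (Fin.last (m + 1))) ^ (j : ℕ)) =
      X (Fin.last m) ^ d +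
        ∑ j : Fin d, rename (Fin.succAboveEmb (Fin.last m)) (TupleGame.slice i₀ (B j)) * X (Fin.last m) ^ (j : ℕ) := by
  cases m with
  | zero => exact i₀.elim0
  | succ m =>
    have hs := CobordantChartPlaneSlice.hasSubst_slice (R := k) (Fin.castSucc i₀)
    rw [map_zero, zero_add, ← coe_substAlgHom hs]
    simp only [map_add, map_mul, map_pow, map_sum]
    simp only [coe_substAlgHom, MultiplicityLift.slice_X_last, MultiplicityLift.slice_rename]

end MonicLinearBlowup

open MonicLinearBlowup MvPowerSeries in
/-- THE BLOW-UP OF A PERMISSIBLE LINEAR CENTRE FROM A MONIC FORM (every characteristic `p`, every dimension `m + 1`, every degree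
`d ≥ 1`, every weight vector `w` on the old variables whose positive entries are prime to `p` — e.g. `w = 𝟙_S`, the centre
`V(x_i (i ∈ S), y)`).  Let `P = y^d + Σ_{j<d} A_j(x') y^j` be PERMISSIBLE: at every exceptional point `c` of the old slots
(`c_l = 0` where `w_l = 0`) the chart transform of every coefficient factors as `A_j ∘ chart_w(c) = s^{d-j} · B_j` with
`B_j(0) = 0` (`hperm`).  Blow up with weights `(w, 1)` (no coordinate change).  Then an exceptional point with `γ = c_y ≠ 0`
carries a unit, and at `γ = 0` the saturated successor is a unit times a coordinate change of the cylinder over the MONIC slice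
`S = y^d + Σ_j (B_j)|_{x'_{i₀} = 0} · y^j` at any live old slot `i₀` (`c_{i₀} ≠ 0`; same number of variables).  Hence `P` is won
as soon as every such SINGULAR slice is won (`hsucc`, which receives the point `c`, the live slot `i₀` and the factorisation
data `B`). -/
theorem won_monic_of_linearBlowup (p : ℕ) (hp : p.Prime) (k : Type) [Field k] [CharP k p] (m d : ℕ) (hd : 0 < d)
    (w : Fin m → ℕ) (hw : ∀ l, 0 < w l → ¬ p ∣ w l) (A : Fin d → MvPowerSeries (Fin m) k)
    (hperm : ∀ c : Fin m → k, (∀ l, w l = 0 → c l = 0) → ∀ j : Fin d, ∃ B : MvPowerSeries (Fin (m + 1)) k,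
      MvPowerSeries.subst (CobordantChart.chart w c) (A j) = MvPowerSeries.X 0 ^ (d - (j : ℕ)) * B ∧
        MvPowerSeries.constantCoeff B = 0)
    (hsucc : ∀ c : Fin m → k, (∀ l, w l = 0 → c l = 0) → ∀ i₀ : Fin m, c i₀ ≠ 0 →
      ∀ B : Fin d → MvPowerSeries (Fin (m + 1)) k,
      (∀ j, MvPowerSeries.subst (CobordantChart.chart w c) (A j) = MvPowerSeries.X 0 ^ (d - (j : ℕ)) * B j) →
      CobordantGame.IsSingular k (MvPowerSeries.X (Fin.last m) ^ d +
        ∑ j : Fin d, MvPowerSeries.rename (Fin.succAboveEmb (Fin.last m))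
          (TupleGame.slice i₀ (B j)) * MvPowerSeries.X (Fin.last m) ^ (j : ℕ)) →
      CobordantGame.Won k (m + 1) (MvPowerSeries.X (Fin.last m) ^ d +
        ∑ j : Fin d, MvPowerSeries.rename (Fin.succAboveEmb (Fin.last m))
          (TupleGame.slice i₀ (B j)) * MvPowerSeries.X (Fin.last m) ^ (j : ℕ))) :
    CobordantGame.Won k (m + 1) (MvPowerSeries.X (Fin.last m) ^ d +
      ∑ j : Fin d, MvPowerSeries.rename (Fin.succAboveEmb (Fin.last m)) (A j) * MvPowerSeries.X (Fin.last m) ^ (j : ℕ)) := by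
  classical
  set P : MvPowerSeries (Fin (m + 1)) k := X (Fin.last m) ^ d +
    ∑ j : Fin d, rename (Fin.succAboveEmb (Fin.last m)) (A j) * X (Fin.last m) ^ (j : ℕ) with hP
  set Wt : Fin (m + 1) → ℕ := Fin.insertNth (α := fun _ => ℕ) (Fin.last m) 1 w with hWtdef
  have hWtlast : Wt (Fin.last m) = 1 := by rw [hWtdef, Fin.insertNth_apply_same]
  have hWtcast : ∀ l, Wt (Fin.castSucc l) = w l := fun l => by rw [hWtdef, insertNth_castSucc]
  -- the move: identity coordinates, weights `Wt = (w, 1)`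
  have hmove : IsMove k (X : Fin (m + 1) → MvPowerSeries (Fin (m + 1)) k) Wt := by
    refine ⟨fun l => constantCoeff_X l, ?_, ⟨Fin.last m, by rw [hWtlast]; exact one_pos⟩⟩
    rw [← FormalCoordChange.linSubst_one, ConeDichotomy.linMat_linSubst, Matrix.det_one]
    exact isUnit_one
  refine Won.move X Wt hmove fun g hg => ?_
  obtain ⟨pt, a, ⟨l, hWl, hptl⟩, hfac, hndvd, hsing⟩ := hg
  have hself : subst (X : Fin (m + 1) → MvPowerSeries (Fin (m + 1)) k) P = P := by
    rw [subst_self]; rfl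
  rw [hself] at hfac
  -- the exceptional point of the old slots and the factorisation data
  set c : Fin m → k := fun l => if 0 < w l then pt (Fin.castSucc l) else 0 with hc
  have hc0 : ∀ l, w l = 0 → c l = 0 := fun l hl => by
    rw [hc]; dsimp only; rw [hl, if_neg (lt_irrefl 0)]
  have hBex := hperm c hc0
  choose B hB hB0 using hBex
  -- the transform and the saturated successor `g₀`
  set γ : k := pt (Fin.last m) with hγ
  set g₀ : MvPowerSeries (Fin (m + 1 + 1)) k := (C γ + X (Fin.last (m + 1))) ^ d +
    ∑ j : Fin d, rename (Fin.succAboveEmb (Fin.last (m + 1))) (B j) * (C γ + X (Fin.last (m + 1))) ^ (j : ℕ) with hg₀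
  have hT : subst (cruxChart k Wt pt) P = X 0 ^ d * g₀ := by
    rw [hP, hWtdef, transform_linear w A pt B hB]
  have hndvd₀ : ¬ X 0 ∣ g₀ := not_X_dvd_g₀ γ B
  have hfac₀ := hfac
  rw [hT] at hfac
  obtain ⟨-, hgg⟩ := X_pow_mul_eq_X_pow_mul 0 hfac hndvd₀ hndvd
  subst hgg
  -- `γ = 0`: otherwise `g₀(0) = γ^d ≠ 0`
  have hγ0 : γ = 0 := by
    have h00 := hsing.1
    rw [hg₀, constantCoeff_g₀ γ B hB0] at h00
    exact pow_eq_zero_iff (n := d) (by omega) |>.mp h00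
  -- the live slot is an old slot `i₀` (the exceptional point is off the vertex and `γ = 0`)
  obtain ⟨i₀, rfl⟩ : ∃ i₀ : Fin m, l = Fin.castSucc i₀ := by
    rcases Fin.eq_castSucc_or_eq_last l with ⟨i, rfl⟩ | rfl
    · exact ⟨i, rfl⟩
    · exact absurd hγ0 hptl
  have hwi₀ : 0 < w i₀ := by rwa [hWtcast] at hWl
  have hci₀ : c i₀ ≠ 0 := by
    rw [hc]; dsimp only; rw [if_pos hwi₀]; exact hptl
  -- the tame slice at `x'_{i₀}`
  obtain ⟨Cb, hCb⟩ : ∃ Cb : Fin (m + 1) → k, ∀ l, Cb l = if 0 < Wt l then pt l else 0 := ⟨_, fun _ => rfl⟩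
  have hconvb : ∀ l, Wt l = 0 → Cb l = 0 := fun l hl => by rw [hCb, hl, if_neg (lt_irrefl 0)]
  have hccb : cruxChart k Wt pt = CobordantChart.chart Wt Cb := by
    rw [show Cb = fun l => if 0 < Wt l then pt l else 0 from funext hCb]
    exact CobordantChart.cruxChart_eq_chart Wt pt
  have hCbi : Cb (Fin.castSucc i₀) ≠ 0 := by rw [hCb, hWtcast, if_pos hwi₀]; exact hptl
  rw [hccb] at hfac₀
  obtain ⟨Φ₂, u, hΦ₂0, hΦ₂det, hu, hgeq⟩ := tameSlice p hp k (m + 1) P Wt Cb hconvb a g₀ hfac₀ (Fin.castSucc i₀) hCbi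
    (by rw [hWtcast]; exact hw i₀ hwi₀)
  set S : MvPowerSeries (Fin (m + 1)) k := subst (fun j : Fin (m + 1 + 1) => if j = (Fin.castSucc i₀).succ
    then (0 : MvPowerSeries (Fin (m + 1)) k) else X (Fin.predAbove (Fin.castSucc i₀) j)) g₀ with hS
  suffices hWS : Won k (m + 1) S by
    rw [hgeq]
    exact (won_unit_mul_iff hu _).mpr ((won_subst_iff hΦ₂0 hΦ₂det _).mpr (won_cyl (Fin.castSucc i₀).succ hWS))
  -- the slice is the monic form of the statement
  have hSeq : S = X (Fin.last m) ^ d +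
      ∑ j : Fin d, rename (Fin.succAboveEmb (Fin.last m)) (TupleGame.slice i₀ (B j)) * X (Fin.last m) ^ (j : ℕ) := by
    rw [hS, hg₀, hγ0, slice_g₀ i₀ B]
  by_cases hSs : IsSingular k S
  · rw [hSeq] at hSs ⊢
    exact hsucc c hc0 i₀ hci₀ B hB hSs
  · exact (wonBy_zero_of_not_isSingular m.succ_pos hSs).won

end Summit.ResolutionOfSingularities.ResolutionOfSingularities.Theorems
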